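/-
Copyright (c) 2026 the pub-hodgecm-mathlib formalisation cell (harness21).  Prover seat hodgecm-mathlib-K2E1-p15 (g0), Track B ∕ K2-LIT «5Res», h413 = `stmt-HodgeConjecture-24833`,
line `K2_E1_TraceFormulaBeta`, route of record `HCCMUnconditional`; dealer K2E1-plan (g7) deal «the `hB` STRIP-BOUND letter at M1 for the (SD) matrix entries» (K2 bus 12:59:39Z,
ruling 13:03:44Z), edition (β): `hB` in the consumer's bytes from PER-POINT self-dual Maass–Selberg data at ONE truncation level.
-/
import Summits.HodgeConjecture.HodgeConjecture.Theorems.K2E1ChiScatteringBoundMaassSelbergOnBoxesU2   -- ★ T1-χ (K2E4-p11): `sqrt_le_mul_sqrt_of_box` (+ ★ Models helpers, ★ p859884 `…_of_truncatedFamily_on'`)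
import Summits.HodgeConjecture.HodgeConjecture.Theorems.K2E1ChiMaassSelbergContinuedLowerCMTwo        -- ★ p860112 (this seat): `poleControl_continued_chi_cm_two_of_truncatedFamily_lower_on'`
import HarnessLib

/-!
# K2·E1 — `K2E1ChiScatteringStripBoundM1CMTwo`: THE `hB` LETTER — `‖⟪φ′_b, M(z)φ_a⟫‖ ≤ B` ON THE HALF-STRIP `½ < Re z ≤ σ₀`, `1 ≤ |Im z|` — FROM PER-POINT SELF-DUAL
# MAASS–SELBERG DATA AT ONE TRUNCATION LEVEL (`U(1,1)_{L∕L⁺}`, edition (β))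

Track B ∕ K2-LIT, crux h413 = `stmt-HodgeConjecture-24833`; cell `hodgecm-mathlib`, squad K2, ENGINE E1; consumer ★ K2E4-p10 `K2E1PseudoEisensteinContourShiftVector` :193∕:214
(`hB : ∀ a b, ∀ z : ℂ, 1 / 2 < z.re → z.re ≤ σ₀ → 1 ≤ |z.im| → ‖⟪φ' b, M z (φ a)⟫_ℂ‖ ≤ B`).  THEOREMS ONLY (no `def`, no `instance`, no notation, no named-fact hypothesis, no `sorry`);
lane `--kind proof --supports stmt-HodgeConjecture-24833 --as helper` (count-neutral).  Closes no socket.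

WHAT ([MoeglinWaldspurger1995, IV.2.3, IV.3.12 (a)]).  For a SELF-DUAL family (`χ = χʷ`) the Maass–Selberg relation of ★ row 14 FILE 1 at a level `T ≥ 1` reads, in the scattering-operator
currency `M(z) : V →ₗ V` of the consumer, `∫_𝔛 Λ^T E(f_z^{φ_a})·conj Λ^T E(f_{z′}^{φ_a}) dμ = cμ·K·(T^{s₁}∕s₁·κm⟪φ_a, φ_a⟫ + T^{s₂}∕s₂·κm⟪M(z′)φ_a, φ_a⟫ − T^{−s₂}∕s₂·κm⟪φ_a, M(z)φ_a⟫ −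
T^{−s₁}∕s₁·κm⟪M(z′)φ_a, M(z)φ_a⟫)` on the sub-tube `1 < Re z′ < Re z` (letter `h4`, one per index `a`, ONE `T` for all `a` — ★ `K2E1TruncationLevelChangeFamilyCMTwo` moves every ball's
continued family to that level).  PER-POINT DATUM (`hdat`): every `z` of the half-strip lies in some open preconnected `D₁` contained in ONE open quadrant `D⁺` or `D⁻`, carrying two open
non-empty sub-tube boxes, on which `w ↦ M(w)φ_a` is holomorphic and a continued truncated family `Fam : ℂ → L²(𝔛)` at level `T` is holomorphic with `Fam w =ᵐ quotFun (Λ^T E(f_w^{φ_a}))` on the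
tube (★ row 15 per ball + ★ level change + my ★ `K2E1ChiEisensteinPoleExclusionCMTwo` topology; the exceptional countable set is avoided by taking a nearby ball point — the datum is
asked AT `z`, and the consumer's entries are continuous off the axis by ★ (d), so `hdat` at every `z` of the open half-strip is what the (α)-export delivers).  THEN, by ★ p859884 ∕ ★ p860112
`poleControl_continued_chi_cm_two_of_truncatedFamily[_lower]_on'` at the self-dual brackets (★ Models) and ★ T1-χ's box algebra at `η = 1`, `‖M(z)φ_a‖ ≤ C(σ₀,T)·‖φ_a‖`, and Cauchy–Schwarz
gives `hB` with `B := C(σ₀,T)·(Σ_a ‖φ_a‖)·(Σ_b ‖φ′_b‖)`.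
* §1 `norm_le_of_truncatedFamily_selfDual_quadrant` — ONE point, either quadrant (Lp currency, self-dual brackets).
* §2 **`hB_of_perPoint_selfDual_truncatedFamily`** — the consumer's `hB` VERBATIM (`∃ B, ∀ a b z, …`).
* §3 **`hB_of_hB_off_exceptional`** — the bound off a thin exceptional set `S` + continuity of the entries on the half-strip ⟹ `hB` at every point.

HONEST LABEL: HC_CM is proved only modulo the 7 printed citations (2 remaining named inputs: hLiu418 = `stmt-HodgeConjecture-24832`, h413 = `stmt-HodgeConjecture-24833`) until rung 0
closes; this file asserts no named fact, is conditional by construction on the letters `h4` (★ row 14 FILE 1 at level `T`) and `hdat` (per-point continued families, edition (α) of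
the M1 print), and closes no socket.

## References
* [MoeglinWaldspurger1995] C. Mœglin, J.-L. Waldspurger, *Spectral decomposition and Eisenstein series* (1995), IV.2.3, IV.3.12 (a).
* [Arthur1980TraceFormulaII] J. Arthur, *A trace formula for reductive groups II*, Compositio Math. 40 (1980), §4.
-/

set_option autoImplicit false
set_option linter.dupNamespace false  -- the mandated namespace repeats the summit's segment (`HodgeConjecture.HodgeConjecture`)

noncomputable section

open Real Set Filter Topology MeasureTheory Measure NumberField IsDedekindDomain
open scoped ENNReal NNReal ComplexConjugate InnerProductSpace
open Literature.NumberTheory.Automorphic Literature.NumberTheory.Automorphic.UnitaryGroup AdelicGroupData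
open Summit.HodgeConjecture.HodgeConjecture.Cruxes.H413.K2E1BorelEisensteinU
open Summit.HodgeConjecture.HodgeConjecture.Cruxes.H413.K2E1ChiMaassSelbergContinuedModelsCMTwo (real_mul_inner_self differentiableOn_inner_conj_comp norm_sq_real_mul_inner_le)
open Summit.HodgeConjecture.HodgeConjecture.Cruxes.H413.K2E1ChiMaassSelbergContinuedOnBoxesCMTwo (poleControl_continued_chi_cm_two_of_truncatedFamily_on')
open Summit.HodgeConjecture.HodgeConjecture.Cruxes.H413.K2E1ChiMaassSelbergContinuedLowerCMTwo (poleControl_continued_chi_cm_two_of_truncatedFamily_lower_on')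
open Summit.HodgeConjecture.HodgeConjecture.Cruxes.H413.K2E1ChiScatteringBoundMaassSelbergU2 (sqrt_le_mul_sqrt_of_box)

namespace Summit.HodgeConjecture.HodgeConjecture.Cruxes.H413.K2E1ChiScatteringStripBoundM1CMTwo

variable (L : Type) [Field L] [NumberField L] [IsCMField L]
  [MeasurableSpace (quasiSplit (↥(maximalRealSubfield L)) L (IsCMField.complexConj L) 2).Adelic]
  {V : Type*} [NormedAddCommGroup V] [InnerProductSpace ℂ V]

/-! ## §1 One point, either quadrant -/

/-- **SELF-DUAL STRIP BOUND AT ONE POINT, EITHER QUADRANT, `L²`-FAMILY CURRENCY**: `D₁` open preconnected inside `D⁺` OR inside `D⁻`, two open non-empty sub-tube boxes, `ψ = M(·)φ`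
holomorphic on `D₁`, `Fam : ℂ → L²(𝔛)` holomorphic on `D₁` with `Fam w =ᵐ quotFun (Λ^T E(f_w^{sec}))` on the tube part, and the self-dual tube relation `h4` at level `T`; then for
`z ∈ D₁` with `Re z ≤ σ₀`, `1 ≤ |Im z|`: `‖ψ z‖ ≤ ((σ₀−½)T^{2(σ₀−½)} + √((σ₀−½)²T^{4(σ₀−½)} + T^{4(σ₀−½)}))·‖φ‖` (★ p859884 ∕ ★ p860112 at the self-dual brackets of ★ Models, then ★
T1-χ `sqrt_le_mul_sqrt_of_box` at `η = 1`). [cite: MoeglinWaldspurger1995, IV.2.3, IV.3.12 (a)] [cite: Arthur1980TraceFormulaII, §4] -/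
theorem norm_le_of_truncatedFamily_selfDual_quadrant
    (μ : Measure (quasiSplit (↥(maximalRealSubfield L)) L (IsCMField.complexConj L) 2).automorphicQuotient)
    (ν : Measure ↥(adelicUnipotent (↥(maximalRealSubfield L)) L (IsCMField.complexConj L) 2)) (𝓕 : Set ↥(adelicUnipotent (↥(maximalRealSubfield L)) L (IsCMField.complexConj L) 2))
    {T : ℝ≥0} (hT : 1 ≤ T) {cμ K κ m : ℝ} (hcμ : 0 < cμ) (hK : 0 < K) (hκ : 0 < κ) (hm : 0 < m)
    {φ : V} (hφ : φ ≠ 0) (sec : (quasiSplit (↥(maximalRealSubfield L)) L (IsCMField.complexConj L) 2).Adelic → ℂ) (ψ : ℂ → V)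
    (h4 : ∀ z z' : ℂ, 1 < z'.re → z'.re < z.re →
      ∫ x, (quasiSplit (↥(maximalRealSubfield L)) L (IsCMField.complexConj L) 2).quotFun (truncation ν 𝓕 T (eisensteinSeriesU (flatSectionU sec z))) x *
          conj ((quasiSplit (↥(maximalRealSubfield L)) L (IsCMField.complexConj L) 2).quotFun (truncation ν 𝓕 T (eisensteinSeriesU (flatSectionU sec z'))) x) ∂μ =
      ((cμ : ℝ) : ℂ) * (((K : ℝ) : ℂ) *
        (((((T : ℝ) : ℝ) : ℂ) ^ (z + conj z' - 1) / (z + conj z' - 1)) * (((κ : ℝ) : ℂ) * (((m : ℝ) : ℂ) * ⟪φ, φ⟫_ℂ))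
          + ((((T : ℝ) : ℝ) : ℂ) ^ (z - conj z') / (z - conj z')) * (((κ : ℝ) : ℂ) * (((m : ℝ) : ℂ) * ⟪ψ z', φ⟫_ℂ))
          - ((((T : ℝ) : ℝ) : ℂ) ^ (-(z - conj z')) / (z - conj z')) * (((κ : ℝ) : ℂ) * (((m : ℝ) : ℂ) * ⟪φ, ψ z⟫_ℂ))
          - ((((T : ℝ) : ℝ) : ℂ) ^ (-(z + conj z' - 1)) / (z + conj z' - 1)) * (((κ : ℝ) : ℂ) * (((m : ℝ) : ℂ) * ⟪ψ z', ψ z⟫_ℂ)))))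
    {D₁ : Set ℂ} (hD₁ : IsOpen D₁) (hD₁c : IsPreconnected D₁)
    (hD₁sub : D₁ ⊆ {z : ℂ | 1 / 2 < z.re ∧ 0 < z.im} ∨ D₁ ⊆ {z : ℂ | 1 / 2 < z.re ∧ z.im < 0})
    {O₁ O₂' : Set ℂ} (hO₁ : IsOpen O₁) (hO₁ne : O₁.Nonempty) (hO₁D : O₁ ⊆ D₁) (hO₂' : IsOpen O₂') (hO₂'ne : O₂'.Nonempty) (hO₂'D : O₂' ⊆ D₁)
    (hsep : ∀ z ∈ O₁, ∀ z' ∈ O₂', 1 < z'.re ∧ z'.re < z.re)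
    (hψ : DifferentiableOn ℂ ψ D₁) (Fam : ℂ → Lp ℂ 2 μ) (hFd : DifferentiableOn ℂ Fam D₁)
    (hFtube : ∀ w ∈ D₁, 1 < w.re → ((Fam w : Lp ℂ 2 μ) : (quasiSplit (↥(maximalRealSubfield L)) L (IsCMField.complexConj L) 2).automorphicQuotient → ℂ) =ᵐ[μ]
      (quasiSplit (↥(maximalRealSubfield L)) L (IsCMField.complexConj L) 2).quotFun (truncation ν 𝓕 T (eisensteinSeriesU (flatSectionU sec w))))
    (σ₀ : ℝ) {z : ℂ} (hz : z ∈ D₁) (hz₂ : z.re ≤ σ₀) (ht : 1 ≤ |z.im|) :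
    ‖ψ z‖ ≤ ((σ₀ - 1 / 2) * (T : ℝ) ^ (2 * (σ₀ - 1 / 2)) + Real.sqrt ((σ₀ - 1 / 2) ^ 2 * (T : ℝ) ^ (4 * (σ₀ - 1 / 2)) + (T : ℝ) ^ (4 * (σ₀ - 1 / 2)))) * ‖φ‖ := by
  have hφn : 0 < ‖φ‖ := norm_pos_iff.2 hφ
  have ha : 0 < κ * m * ‖φ‖ ^ 2 := by positivity
  have hkm : 0 < κ * m := mul_pos hκ hm
  have hT0 : 0 < (T : ℝ) := lt_of_lt_of_le one_pos (by exact_mod_cast hT)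
  have hB₂ : DifferentiableOn ℂ (fun w : ℂ => ((κ : ℝ) : ℂ) * (((m : ℝ) : ℂ) * ⟪ψ (conj w), φ⟫_ℂ)) {w : ℂ | conj w ∈ D₁} :=
    ((differentiableOn_inner_conj_comp hD₁ hψ φ).const_mul _).const_mul _
  have hB₃ : DifferentiableOn ℂ (fun z : ℂ => ((κ : ℝ) : ℂ) * (((m : ℝ) : ℂ) * ⟪φ, ψ z⟫_ℂ)) D₁ :=
    (((innerSL ℂ φ).differentiable.comp_differentiableOn hψ).const_mul _).const_mul _
  have hB₃₂ : ∀ z ∈ D₁, ((κ : ℝ) : ℂ) * (((m : ℝ) : ℂ) * ⟪φ, ψ z⟫_ℂ) = conj (((κ : ℝ) : ℂ) * (((m : ℝ) : ℂ) * ⟪ψ z, φ⟫_ℂ)) := fun z _ => by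
    rw [map_mul, map_mul, Complex.conj_ofReal, Complex.conj_ofReal, inner_conj_symm]
  have hB₄₁ : ∀ z' ∈ D₁, DifferentiableOn ℂ (fun z : ℂ => ((κ : ℝ) : ℂ) * (((m : ℝ) : ℂ) * ⟪ψ z', ψ z⟫_ℂ)) D₁ := fun z' _ =>
    (((innerSL ℂ (ψ z')).differentiable.comp_differentiableOn hψ).const_mul _).const_mul _
  have hB₄₂ : ∀ z ∈ D₁, DifferentiableOn ℂ (fun w : ℂ => ((κ : ℝ) : ℂ) * (((m : ℝ) : ℂ) * ⟪ψ (conj w), ψ z⟫_ℂ)) {w : ℂ | conj w ∈ D₁} := fun z _ =>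
    ((differentiableOn_inner_conj_comp hD₁ hψ (ψ z)).const_mul _).const_mul _
  -- the (a2) box bound for `b = κm‖ψ‖²`, in either quadrant
  have h2 : ∀ {x₁ x₂ η : ℝ}, 0 < x₁ → (z.re - 1 / 2) ∈ Set.Icc x₁ x₂ → 0 < η → η ≤ |z.im| →
      κ * m * ‖ψ z‖ ^ 2 ≤ (x₂ * (T : ℝ) ^ (2 * x₂) * Real.sqrt (κ * m * ‖φ‖ ^ 2) / η +
        Real.sqrt (x₂ ^ 2 * (T : ℝ) ^ (4 * x₂) * (κ * m * ‖φ‖ ^ 2) / η ^ 2 + (κ * m * ‖φ‖ ^ 2) * (T : ℝ) ^ (4 * x₂))) ^ 2 := by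
    rcases hD₁sub with hsub | hsub
    · exact (poleControl_continued_chi_cm_two_of_truncatedFamily_on' L hD₁ hD₁c hsub hO₁ hO₁ne hO₁D hO₂' hO₂'ne hO₂'D hsep μ ν 𝓕 hT hcμ hK ha
        (b := fun z => κ * m * ‖ψ z‖ ^ 2) (fun z _ => by positivity)
        (B₁ := ((κ : ℝ) : ℂ) * (((m : ℝ) : ℂ) * ⟪φ, φ⟫_ℂ)) (B₂ := fun z' => ((κ : ℝ) : ℂ) * (((m : ℝ) : ℂ) * ⟪ψ z', φ⟫_ℂ))
        (B₃ := fun z => ((κ : ℝ) : ℂ) * (((m : ℝ) : ℂ) * ⟪φ, ψ z⟫_ℂ)) (B₄ := fun z z' => ((κ : ℝ) : ℂ) * (((m : ℝ) : ℂ) * ⟪ψ z', ψ z⟫_ℂ))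
        (real_mul_inner_self κ m φ) hB₂ hB₃ hB₃₂ hB₄₁ hB₄₂ (fun z _ => real_mul_inner_self κ m (ψ z)) (fun z _ => norm_sq_real_mul_inner_le hκ.le hm.le (ψ z) φ)
        sec Fam hFd hFtube h4 hz).2.1
    · exact (poleControl_continued_chi_cm_two_of_truncatedFamily_lower_on' L hD₁ hD₁c hsub hO₁ hO₁ne hO₁D hO₂' hO₂'ne hO₂'D hsep μ ν 𝓕 hT hcμ hK ha
        (b := fun z => κ * m * ‖ψ z‖ ^ 2) (fun z _ => by positivity)
        (B₁ := ((κ : ℝ) : ℂ) * (((m : ℝ) : ℂ) * ⟪φ, φ⟫_ℂ)) (B₂ := fun z' => ((κ : ℝ) : ℂ) * (((m : ℝ) : ℂ) * ⟪ψ z', φ⟫_ℂ))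
        (B₃ := fun z => ((κ : ℝ) : ℂ) * (((m : ℝ) : ℂ) * ⟪φ, ψ z⟫_ℂ)) (B₄ := fun z z' => ((κ : ℝ) : ℂ) * (((m : ℝ) : ℂ) * ⟪ψ z', ψ z⟫_ℂ))
        (real_mul_inner_self κ m φ) hB₂ hB₃ hB₃₂ hB₄₁ hB₄₂ (fun z _ => real_mul_inner_self κ m (ψ z)) (fun z _ => norm_sq_real_mul_inner_le hκ.le hm.le (ψ z) φ)
        sec Fam hFd hFtube h4 hz).2.1
  have hz₁ : 1 / 2 < z.re := by
    rcases hD₁sub with hsub | hsub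
    · exact (hsub hz).1
    · exact (hsub hz).1
  have hx₂ : 0 ≤ σ₀ - 1 / 2 := by linarith
  have h := @h2 (z.re - 1 / 2) (σ₀ - 1 / 2) 1 (by linarith) ⟨le_rfl, by linarith⟩ one_pos ht
  have h3 := sqrt_le_mul_sqrt_of_box (a := κ * m * ‖φ‖ ^ 2) hx₂ one_pos hT0 h
  simp only [div_one, one_pow] at h3
  have e1 : Real.sqrt (κ * m * ‖ψ z‖ ^ 2) = Real.sqrt (κ * m) * ‖ψ z‖ := by rw [Real.sqrt_mul hkm.le, Real.sqrt_sq (norm_nonneg _)]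
  have e2 : Real.sqrt (κ * m * ‖φ‖ ^ 2) = Real.sqrt (κ * m) * ‖φ‖ := by rw [Real.sqrt_mul hkm.le, Real.sqrt_sq (norm_nonneg _)]
  rw [e1, e2] at h3
  have h4' : Real.sqrt (κ * m) * ‖ψ z‖ ≤ Real.sqrt (κ * m) *
      (((σ₀ - 1 / 2) * (T : ℝ) ^ (2 * (σ₀ - 1 / 2)) + Real.sqrt ((σ₀ - 1 / 2) ^ 2 * (T : ℝ) ^ (4 * (σ₀ - 1 / 2)) + (T : ℝ) ^ (4 * (σ₀ - 1 / 2)))) * ‖φ‖) := by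
    calc Real.sqrt (κ * m) * ‖ψ z‖ ≤ _ := h3
      _ = _ := by ring
  exact le_of_mul_le_mul_left h4' (Real.sqrt_pos.2 hkm)

/-! ## §2 The letter `hB` in the consumer's bytes -/

/-- **THE `hB` LETTER FROM PER-POINT SELF-DUAL MAASS–SELBERG DATA AT ONE LEVEL** (module docstring): finitely many test sections `φ : α → V`, `φ′ : β → V`, the continued scattering
operator `M : ℂ → V →ₗ V`, one level `T ≥ 1`, the self-dual tube relations `h4 a` (★ row 14 FILE 1) for the sections `sec a` of `φ a`, and the per-point datum `hdat`; THEN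
`∃ B, ∀ a b z, ½ < Re z → Re z ≤ σ₀ → 1 ≤ |Im z| → ‖⟪φ′ b, M z (φ a)⟫‖ ≤ B` — ★ K2E4-p10 `pseudoEisenstein_contourShift_vector_of_letters`'s `hB` VERBATIM.
[cite: MoeglinWaldspurger1995, IV.3.12 (a)] [cite: Arthur1980TraceFormulaII, §4] -/
theorem hB_of_perPoint_selfDual_truncatedFamily
    (μ : Measure (quasiSplit (↥(maximalRealSubfield L)) L (IsCMField.complexConj L) 2).automorphicQuotient)
    (ν : Measure ↥(adelicUnipotent (↥(maximalRealSubfield L)) L (IsCMField.complexConj L) 2)) (𝓕 : Set ↥(adelicUnipotent (↥(maximalRealSubfield L)) L (IsCMField.complexConj L) 2))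
    {T : ℝ≥0} (hT : 1 ≤ T) {cμ K κ m : ℝ} (hcμ : 0 < cμ) (hK : 0 < K) (hκ : 0 < κ) (hm : 0 < m) (σ₀ : ℝ)
    {α β : Type*} [Fintype α] [Fintype β] (φ : α → V) (φ' : β → V) (M : ℂ → V →ₗ[ℂ] V)
    (sec : α → (quasiSplit (↥(maximalRealSubfield L)) L (IsCMField.complexConj L) 2).Adelic → ℂ)
    (h4 : ∀ a, ∀ z z' : ℂ, 1 < z'.re → z'.re < z.re →
      ∫ x, (quasiSplit (↥(maximalRealSubfield L)) L (IsCMField.complexConj L) 2).quotFun (truncation ν 𝓕 T (eisensteinSeriesU (flatSectionU (sec a) z))) x *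
          conj ((quasiSplit (↥(maximalRealSubfield L)) L (IsCMField.complexConj L) 2).quotFun (truncation ν 𝓕 T (eisensteinSeriesU (flatSectionU (sec a) z'))) x) ∂μ =
      ((cμ : ℝ) : ℂ) * (((K : ℝ) : ℂ) *
        (((((T : ℝ) : ℝ) : ℂ) ^ (z + conj z' - 1) / (z + conj z' - 1)) * (((κ : ℝ) : ℂ) * (((m : ℝ) : ℂ) * ⟪φ a, φ a⟫_ℂ))
          + ((((T : ℝ) : ℝ) : ℂ) ^ (z - conj z') / (z - conj z')) * (((κ : ℝ) : ℂ) * (((m : ℝ) : ℂ) * ⟪M z' (φ a), φ a⟫_ℂ))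
          - ((((T : ℝ) : ℝ) : ℂ) ^ (-(z - conj z')) / (z - conj z')) * (((κ : ℝ) : ℂ) * (((m : ℝ) : ℂ) * ⟪φ a, M z (φ a)⟫_ℂ))
          - ((((T : ℝ) : ℝ) : ℂ) ^ (-(z + conj z' - 1)) / (z + conj z' - 1)) * (((κ : ℝ) : ℂ) * (((m : ℝ) : ℂ) * ⟪M z' (φ a), M z (φ a)⟫_ℂ)))))
    (hdat : ∀ a, φ a ≠ 0 → ∀ z : ℂ, 1 / 2 < z.re → z.re ≤ σ₀ → 1 ≤ |z.im| →
      ∃ (D₁ O₁ O₂' : Set ℂ) (Fam : ℂ → Lp ℂ 2 μ), IsOpen D₁ ∧ IsPreconnected D₁ ∧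
        (D₁ ⊆ {z : ℂ | 1 / 2 < z.re ∧ 0 < z.im} ∨ D₁ ⊆ {z : ℂ | 1 / 2 < z.re ∧ z.im < 0}) ∧
        IsOpen O₁ ∧ O₁.Nonempty ∧ O₁ ⊆ D₁ ∧ IsOpen O₂' ∧ O₂'.Nonempty ∧ O₂' ⊆ D₁ ∧ (∀ w ∈ O₁, ∀ w' ∈ O₂', 1 < w'.re ∧ w'.re < w.re) ∧ z ∈ D₁ ∧
        DifferentiableOn ℂ (fun w => M w (φ a)) D₁ ∧ DifferentiableOn ℂ Fam D₁ ∧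
        ∀ w ∈ D₁, 1 < w.re → ((Fam w : Lp ℂ 2 μ) : (quasiSplit (↥(maximalRealSubfield L)) L (IsCMField.complexConj L) 2).automorphicQuotient → ℂ) =ᵐ[μ]
          (quasiSplit (↥(maximalRealSubfield L)) L (IsCMField.complexConj L) 2).quotFun (truncation ν 𝓕 T (eisensteinSeriesU (flatSectionU (sec a) w)))) :
    ∃ B : ℝ, ∀ a b, ∀ z : ℂ, 1 / 2 < z.re → z.re ≤ σ₀ → 1 ≤ |z.im| → ‖⟪φ' b, M z (φ a)⟫_ℂ‖ ≤ B := by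
  classical
  set C : ℝ := (σ₀ - 1 / 2) * (T : ℝ) ^ (2 * (σ₀ - 1 / 2)) + Real.sqrt ((σ₀ - 1 / 2) ^ 2 * (T : ℝ) ^ (4 * (σ₀ - 1 / 2)) + (T : ℝ) ^ (4 * (σ₀ - 1 / 2))) with hC
  refine ⟨(∑ b, ‖φ' b‖) * (|C| * ∑ a, ‖φ a‖), fun a b z hz₁ hz₂ ht => ?_⟩
  -- the operator bound at `z` for the index `a`
  have hMz : ‖M z (φ a)‖ ≤ |C| * ‖φ a‖ := by
    by_cases hφ : φ a = 0
    · simp [hφ]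
    · obtain ⟨D₁, O₁, O₂', Fam, hD₁, hD₁c, hD₁sub, hO₁, hO₁ne, hO₁D, hO₂', hO₂'ne, hO₂'D, hsep, hzD, hψ, hFd, hFtube⟩ := hdat a hφ z hz₁ hz₂ ht
      have h := norm_le_of_truncatedFamily_selfDual_quadrant L μ ν 𝓕 hT hcμ hK hκ hm hφ (sec a) (fun w => M w (φ a)) (h4 a) hD₁ hD₁c hD₁sub hO₁ hO₁ne hO₁D hO₂' hO₂'ne hO₂'D hsep
        hψ Fam hFd hFtube σ₀ hzD hz₂ ht
      exact h.trans (mul_le_mul_of_nonneg_right (le_abs_self C) (norm_nonneg _))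
  -- Cauchy–Schwarz and the finite sums
  calc ‖⟪φ' b, M z (φ a)⟫_ℂ‖ ≤ ‖φ' b‖ * ‖M z (φ a)‖ := norm_inner_le_norm _ _
    _ ≤ ‖φ' b‖ * (|C| * ‖φ a‖) := mul_le_mul_of_nonneg_left hMz (norm_nonneg _)
    _ ≤ (∑ b, ‖φ' b‖) * (|C| * ∑ a, ‖φ a‖) := by
        refine mul_le_mul (Finset.single_le_sum (fun b _ => norm_nonneg (φ' b)) (Finset.mem_univ b)) ?_ (by positivity) (Finset.sum_nonneg fun b _ => norm_nonneg _)
        exact mul_le_mul_of_nonneg_left (Finset.single_le_sum (fun a _ => norm_nonneg (φ a)) (Finset.mem_univ a)) (abs_nonneg _)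

/-! ## §3 Off a thin exceptional set: the bound passes to every point of the half-strip by continuity -/

omit [MeasurableSpace (quasiSplit (↥(maximalRealSubfield L)) L (IsCMField.complexConj L) 2).Adelic] in
/-- **FROM «`hB` OFF AN EXCEPTIONAL SET» TO `hB`**: if the entries `z ↦ ⟪φ′ b, M z (φ a)⟫` are bounded by `B` at every point of the half-strip `R = {½ < Re ≤ σ₀, 1 ≤ |Im|}` outside a set
`S`, every point of `R` is a limit of points of `R ∖ S` (e.g. `S` countable), and the entries are continuous on `R` (★ (d): no pole off the real axis, so the normal-form continuation is
analytic there), then `hB` holds at EVERY point of `R` (`le_of_tendsto`).  This is how the per-ball exports (edition (α): families on `(D^± ∩ D_n ∩ U_n) ∖ P`, `(D_n ∖ U_n) ∪ P` countable)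
reach the consumer's unrestricted quantifier. [cite: MoeglinWaldspurger1995, IV.3.12 (a)] -/
theorem hB_of_hB_off_exceptional {α β : Type*} (φ : α → V) (φ' : β → V) (M : ℂ → V →ₗ[ℂ] V) (σ₀ : ℝ) (S : Set ℂ) {B : ℝ}
    (hoff : ∀ a b, ∀ z : ℂ, 1 / 2 < z.re → z.re ≤ σ₀ → 1 ≤ |z.im| → z ∉ S → ‖⟪φ' b, M z (φ a)⟫_ℂ‖ ≤ B)
    (hdense : ∀ z : ℂ, 1 / 2 < z.re → z.re ≤ σ₀ → 1 ≤ |z.im| →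
      ∃ u : ℕ → ℂ, (∀ k, 1 / 2 < (u k).re ∧ (u k).re ≤ σ₀ ∧ 1 ≤ |(u k).im| ∧ u k ∉ S) ∧ Tendsto u atTop (𝓝 z))
    (hcont : ∀ a b, ∀ z : ℂ, 1 / 2 < z.re → z.re ≤ σ₀ → 1 ≤ |z.im| →
      ContinuousWithinAt (fun w => ⟪φ' b, M w (φ a)⟫_ℂ) {w : ℂ | 1 / 2 < w.re ∧ w.re ≤ σ₀ ∧ 1 ≤ |w.im|} z) :
    ∀ a b, ∀ z : ℂ, 1 / 2 < z.re → z.re ≤ σ₀ → 1 ≤ |z.im| → ‖⟪φ' b, M z (φ a)⟫_ℂ‖ ≤ B := by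
  intro a b z hz₁ hz₂ ht
  obtain ⟨u, hu, hlim⟩ := hdense z hz₁ hz₂ ht
  have hmem : ∀ k, u k ∈ {w : ℂ | 1 / 2 < w.re ∧ w.re ≤ σ₀ ∧ 1 ≤ |w.im|} := fun k => ⟨(hu k).1, (hu k).2.1, (hu k).2.2.1⟩
  have hlim' : Tendsto u atTop (𝓝[{w : ℂ | 1 / 2 < w.re ∧ w.re ≤ σ₀ ∧ 1 ≤ |w.im|}] z) :=
    tendsto_nhdsWithin_iff.2 ⟨hlim, Eventually.of_forall hmem⟩
  have hT : Tendsto (fun k => ‖⟪φ' b, M (u k) (φ a)⟫_ℂ‖) atTop (𝓝 ‖⟪φ' b, M z (φ a)⟫_ℂ‖) :=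
    ((hcont a b z hz₁ hz₂ ht).tendsto.comp hlim').norm
  exact le_of_tendsto hT (Eventually.of_forall fun k => hoff a b (u k) (hu k).1 (hu k).2.1 (hu k).2.2.1 (hu k).2.2.2)

end Summit.HodgeConjecture.HodgeConjecture.Cruxes.H413.K2E1ChiScatteringStripBoundM1CMTwo

end
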